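import Literature.NumberTheory.EllipticCurves.X049FrobeniusTraces
import Literature.NumberTheory.QuadraticFields.OmegaNegSevenHeckeSums
import HarnessLib

/-!
# Rajwade's Theorem 4 for `X₀(49)`, coefficient by coefficient: `a_m(49a1) = Σ_{N λ = m, λ ≡ 1,2,4 (√−7)} λ`

Topic `Literature/NumberTheory/EllipticCurves`, namespace `Literature.NumberTheory.EllipticCurves.X049` (sequel to
`X049FrobeniusTraces`, with `QuadraticFields/OmegaNegSevenHeckeSums`).  THEOREMS ONLY.  Deuring's «`L(E, s) = L(s, ψ)`» for
`E = X₀(49) = 49a1` (`y² + xy = x³ − x² − 2x − 1`, CM by `ℤ[ω]`, `ω = ½(1+√−7)`), in the printed form of Rajwade's Theorem 4,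
«`L_D(s) = Σ_{λ ≡ 1, 2, 4 (mod √−7)} (D/λ) λ̄ (Nλ)^{−s}`» at `D = 1`, read off on Mathlib's `WeierstrassCurve.LFunction`:

* ★ `lFunction_eq_heckeSum` — **for every `m`, `a_m(E) = S(m) := Σ_{λ ∈ ℤ[ω], N λ = m, chi λ = 1} λ`** in `ℤ[ω] = QuadraticAlgebra ℤ (−2) 1`
  (`OmegaNegSeven.heckeSum`), MODULO the group order formula `groupOrder_A7` (Silverberg 2010 (2.1) = Rajwade Thm. 3: the sign of
  `a_p` at the split primes).  Both sides are multiplicative (`isMultiplicative_LFunction`, `heckeSum_mul_of_coprime`) and agree on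
  prime powers: `7^k` (additive / `chi = 0` on `(√−7)`), inert `p^k` (`a_{p^{2j}} = (−p)^j = S(p^{2j})`, proved on both sides),
  split `p^k` (`a_{p^k} = Σ π^j π̄^{k−j} = S(p^k)` once `a_p = π + π̄` for the normalised `π`, `4p = u² + 7v²`, `a_p = (u/7)u = u`);
* `lFunction_apply_prime_eq_add_star` — `a_p = π + π̄` for the normalised `π` of norm `p ≠ 7` (mod `groupOrder_A7`);
* `re_heckeSum`, `im_heckeSum`, `two_mul_re_add_im_heckeSum` — `S(m)` is the integer `a_m`: `re S(m) = a_m`, `im S(m) = 0`.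

## References
* A. R. Rajwade, J. Austral. Math. Soc. A 24 (1977), Thm. 3 and Thm. 4. [Rajwade1977]
* A. Silverberg, Contemp. Math. 521 (2010), (2.1), Table 1. [Silverberg2010]
* K. Ireland, M. Rosen, *A Classical Introduction to Modern Number Theory* (1990), Ch. 18 §6, proof of Theorem 7 (the model:
  both sides multiplicative, compare prime powers). [IrelandRosen1990]

## Mathlib / tree search
Tree: `X049.{lFunction_apply_prime_of_groupOrder, lFunction_apply_prime_pow_of_split, lFunction_apply_prime_pow_of_inert,
lFunction_apply_seven_pow, lFunction_apply_two}`, `OmegaNegSeven.{heckeSum_one, heckeSum_of_seven_dvd, heckeSum_mul_of_coprime,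
heckeSum_pow_of_inert, heckeSum_pow_of_split, exists_chi_eq_one_norm_eq, natCast_eq_mul_star, self_add_star, four_mul_norm, chi_eq}`,
`WeierstrassCurve.isMultiplicative_LFunction`.  Mathlib: `Nat.recOnPosPrimePosCoprime`.
-/

noncomputable section

open scoped Classical NumberTheorySymbols

namespace Literature.NumberTheory.EllipticCurves

namespace X049

open _root_.WeierstrassCurve QuadraticAlgebra Literature.NumberTheory.QuadraticFields
  Literature.NumberTheory.QuadraticFields.OmegaNegSeven

/-- **`a_p(E) = π + π̄` for the normalised `π ∈ ℤ[ω]` of norm `p ≠ 7`** (`chi π = 1`, i.e. `π ≡ 1, 2, 4 (mod √−7)`), modulo the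
group order formula: with `π = ½(u + v√−7)`, `u = 2 re π + im π`, one has `4p = u² + 7v²`, `(u/7) = chi π = 1` and `π + π̄ = u`.
[cite: Rajwade1977, Thm 3] [cite: Silverberg2010, (2.1)] -/
theorem lFunction_apply_prime_eq_add_star (hG : groupOrder_A7) {p : ℕ} (hp : p.Prime) (hp7 : p ≠ 7)
    {π : QuadraticAlgebra ℤ (-2) 1} (hπ : chi π = 1) (h : π.norm = p) :
    (((E.map (Int.castRingHom ℚ)).LFunction p : ℤ) : QuadraticAlgebra ℤ (-2) 1) = π + star π := by
  have huv : (2 * π.re + π.im) ^ 2 + 7 * π.im ^ 2 = 4 * p := by rw [← h, four_mul_norm]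
  rw [lFunction_apply_prime_of_groupOrder hG hp hp7 huv, ← chi_eq π, hπ, one_mul, self_add_star]

/-- `S(0) = 0` (no element of norm `0` is normalised: `chi 0 = 0`). [cite: Rajwade1977, Thm 4] -/
theorem heckeSum_zero : heckeSum 0 = 0 := by
  rw [heckeSum]
  refine Finset.sum_eq_zero fun z hz ↦ ?_
  obtain ⟨hn, hc⟩ := mem_heckeNormEq.mp hz
  rw [Nat.cast_zero, norm_eq_zero_iff'] at hn
  exact hn

/-- ★ **Rajwade's Theorem 4 for `X₀(49)`, coefficient by coefficient: `a_m(E) = S(m) = Σ_{N λ = m, λ ≡ 1,2,4 (mod √−7)} λ` for every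
`m`**, in `ℤ[ω]`, MODULO the group order formula `groupOrder_A7` (Silverberg 2010 (2.1)); i.e. Deuring's `L(E/ℚ, s) = L(s, ψ)` with
`ψ((λ)) = (λ/√−7)₂ λ̄` for `E = 49a1`.  Both sides are multiplicative and agree on prime powers (additive `7`, inert `p ≡ 3, 5, 6`,
split `p ≡ 1, 2, 4 (mod 7)`). [cite: Rajwade1977, Thm 4] [cite: Silverberg2010, (2.1)] [cite: IrelandRosen1990, Ch. 18 §6, proof of Theorem 7] -/
theorem lFunction_eq_heckeSum (hG : groupOrder_A7) (m : ℕ) :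
    (((E.map (Int.castRingHom ℚ)).LFunction m : ℤ) : QuadraticAlgebra ℤ (-2) 1) = heckeSum m := by
  induction m using Nat.recOnPosPrimePosCoprime with
  | zero => rw [ArithmeticFunction.map_zero, Int.cast_zero, heckeSum_zero]
  | one => rw [(E.map (Int.castRingHom ℚ)).isMultiplicative_LFunction.map_one, heckeSum_one, Int.cast_one]
  | prime_pow p k hp hk =>
    obtain ⟨k', rfl⟩ : ∃ k', k = k' + 1 := ⟨k - 1, by omega⟩
    have hcases : p = 7 ∨ (p % 7 = 3 ∨ p % 7 = 5 ∨ p % 7 = 6) ∨ (p % 7 = 1 ∨ p % 7 = 2 ∨ p % 7 = 4) := by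
      by_cases h7 : p % 7 = 0
      · left
        exact ((Nat.prime_dvd_prime_iff_eq (by norm_num) hp).mp (Nat.dvd_of_mod_eq_zero h7)).symm
      · right; omega
    rcases hcases with rfl | hinert | hsplit
    · -- the ramified prime `7`: both sides vanish
      rw [lFunction_apply_seven_pow k', Int.cast_zero, heckeSum_of_seven_dvd (dvd_pow_self 7 (Nat.succ_ne_zero k'))]
    · -- inert primes
      obtain ⟨j, hj | hj⟩ := Nat.even_or_odd' (k' + 1)
      · rw [hj, (lFunction_apply_prime_pow_of_inert hp hinert j).1, (heckeSum_pow_of_inert hp hinert j).1]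
        push_cast
        ring
      · rw [hj, (lFunction_apply_prime_pow_of_inert hp hinert j).2, (heckeSum_pow_of_inert hp hinert j).2, Int.cast_zero]
    · -- split primes: `a_{p^k} = Σ π^j π̄^{k−j} = S(p^k)`
      have hp7 : p ≠ 7 := by rintro rfl; norm_num at hsplit
      obtain ⟨π, hπ, hπp⟩ := exists_chi_eq_one_norm_eq hp hsplit
      have h1 := lFunction_apply_prime_eq_add_star hG hp hp7 hπ hπp
      rw [lFunction_apply_prime_pow_of_split hp hp7 h1 (natCast_eq_mul_star hπp) (k' + 1),
        heckeSum_pow_of_split hp hp7 hπ hπp (k' + 1)]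
  | coprime a b ha hb hab iha ihb =>
    rw [(E.map (Int.castRingHom ℚ)).isMultiplicative_LFunction.map_mul_of_coprime hab, Int.cast_mul, iha, ihb,
      heckeSum_mul_of_coprime hab]

/-- `re S(m) = a_m(E)`: the Hecke sum is the integer `a_m`. [cite: Rajwade1977, Thm 4] -/
theorem re_heckeSum (hG : groupOrder_A7) (m : ℕ) : (heckeSum m).re = (E.map (Int.castRingHom ℚ)).LFunction m := by
  rw [← lFunction_eq_heckeSum hG m, re_intCast, Int.cast_id]

/-- `im S(m) = 0`. [cite: Rajwade1977, Thm 4] -/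
theorem im_heckeSum (hG : groupOrder_A7) (m : ℕ) : (heckeSum m).im = 0 := by
  rw [← lFunction_eq_heckeSum hG m, im_intCast]

/-- **`Σ_{N λ = m, chi λ = 1} (λ + λ̄) = 2 a_m(E)`** in the coordinate `2 re + im = λ + λ̄`: the trace form of Rajwade's Theorem 4, as
needed for the weight-one theta series with weight `y₁ = 2 re λ + im λ`. [cite: Rajwade1977, Thm 4] -/
theorem sum_heckeNormEq_trace (hG : groupOrder_A7) (m : ℕ) :
    ∑ z ∈ heckeNormEq m, (2 * z.re + z.im) = 2 * (E.map (Int.castRingHom ℚ)).LFunction m := by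
  have hre : ∑ z ∈ heckeNormEq m, z.re = (heckeSum m).re := by
    rw [heckeSum]
    induction (heckeNormEq m) using Finset.cons_induction with
    | empty => simp
    | cons a s ha ih => rw [Finset.sum_cons, Finset.sum_cons, re_add, ih]
  have him : ∑ z ∈ heckeNormEq m, z.im = (heckeSum m).im := by
    rw [heckeSum]
    induction (heckeNormEq m) using Finset.cons_induction with
    | empty => simp
    | cons a s ha ih => rw [Finset.sum_cons, Finset.sum_cons, im_add, ih]
  rw [Finset.sum_add_distrib, ← Finset.mul_sum, hre, him, re_heckeSum hG, im_heckeSum hG]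
  ring

/-- **`Σ_{N z = m} chi z · (2 re z + im z) = 4 a_m(E)`** — the sum over ALL elements of norm `m` of `ℤ[ω]` (the lattice form used by
the theta series): twice the normalised sum, by `z ↦ −z`. [cite: Rajwade1977, Thm 4] -/
theorem sum_normEq_chi_mul_trace (hG : groupOrder_A7) (m : ℕ) :
    ∑ z ∈ normEq m, chi z * (2 * z.re + z.im) = 4 * (E.map (Int.castRingHom ℚ)).LFunction m := by
  have h := sum_normEq_chi_mul_eq_two_mul (M := ℤ) (fun z ↦ 2 * z.re + z.im)
    (fun z ↦ by simp only [re_neg, im_neg]; ring) m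
  simp only [smul_eq_mul] at h
  rw [h, sum_heckeNormEq_trace hG]
  ring

end X049

end Literature.NumberTheory.EllipticCurves

end
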